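import Summits.QuantumFields.YangMills.Theorems.UnitScaleTiltHalvingP1FlatCoreTransportZd
import Summits.QuantumFields.YangMills.Theorems.UnitScaleTiltHalvingP1FlatCoreTransport
import Summits.QuantumFields.YangMills.Theorems.UnitScaleTiltHalvingP1FlatPillarPrime
import Summits.QuantumFields.YangMills.Theorems.UnitScaleTiltProp8HalvingSliceDictionary
import HarnessLib

/-!
# Route `UnitScaleTilt`, crux K1 child «MinimiserStabilityRegPr» (stmt-QuantumFields-19200), registered stub V2′ `stub_halvingStep` (v10 `BirthV10`) —
# **J5b TRANSPORT, PART 2b (ASSEMBLY): N05's FLAT LANDAU CONDITION ON ITS WINDOW ⟹ THE PILLAR's LANDAU ROW (iv) ON THE ROUTE's CUBE TOWER** — through the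
# pointwise junction of the chart one-forms on the bonds of `□₀^{route}`, J1b's representatives ∕ levelwise inclusion ∕ cell dictionary, part 2a's constancy of
# `Q′(1)ᵀμ` on the route cells, and part 1's cell currency of (iv)

Cell `ym3-torus` (HUMAN RULING D-0037, YM ladder rung R3 — continuum SU(2) YM₃ on the three-torus is a RUNG, NOT the Clay problem), width seat `ym-ust-19936-w7`
gen 4, cross-item hand on line H (★★OWNER ACK 45 (a) J5; LEAD-H L-5 «J5b := transport of (iv) along J1b»; tag worded by the OWNER:
`--supports stmt-QuantumFields-19200 --as helper`).  Definition-free, 0 sorry, standard axioms.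

WHY.  LEAD-H RULING L-5 (D1) runs [Balaban1985RegularSpaces] Prop. 5 at N05's OWN cube member on `ℤ³` (window `Ω₀ = □₀^{N05} = cube L a M′ ρ′ k 0`, layers `Λs`), whose
Landau output is the flat multiplier form `Δ↾Ω₀ ∂*X = Q′(1)ᵀμ` on `Ω₀` (✓`IsLandau138`, ✓`p5Step_ofConstraint_of_HFP`); the pillar wants (iv) for the TORUS one-form `A`
on the route's tower `cubeSeqMT3` (✓`P1FlatPillarAt'`).  The junction is POINTWISE (LEAD-H 11:27:33Z): `A⟨0+w, ν⟩ = X w ν` on the bonds of `□₀^{route}` read at their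
window representatives.  THIS FILE assembles: §1 locality of the flat stencils `D^{η*}_1`, `Δ^η_1` (three-point ∕ two-bond footprints; the `Ω₀`-indicator is invisible two
sites inside `Ω₀`); §2 the footprint junction `Δ^η_1D^{η*}_1X (z) = (Δ∂*A)(0+z)` from pointwise agreement on the box `[z−2, z+1]` (✓`covLap_covDivB_one_pull`); §3 margins:
the box `[z−2, z+2]` of a site of `□₁^{N05}` lies in `□₀^{N05}` (`ρ′ ≥ 2`, ✓`margin_succ`), torus neighbours within `2` of a site of `□₁^{route}` lie in `□₀^{route}` (`S ≥ 2`,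
✓`sep22_cubeFinM_zero`), nesting of the route cubes; §4 ★★★ `multiplierForm_of_flatLandau_window` — (iv) on `cubeSeqMT3 F n K x₀ ρ S M hM` with lattice factor `η⁻¹`
from the four displayed inputs (flat Landau on `Ω₀`, pointwise junction, J1b's window binders, the layers' vanishing property), by ✓`multiplierForm_of_cellConst` (part 1)
with the cell values read through ✓`QT_one_eq_of_flm_eq` (part 2a), ✓`iterBlockOf_cover_eq_iff_flm_eq` ∕ ✓`mem_cube_of_cover_mem_cubeSetM` ∕ ✓`lift_add_rel_mem_cube_zero`
(J1b); level-0 cells are singletons and impose nothing.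
HONEST SCOPE.  Bookkeeping over landed identities; the Landau condition, the chart and the junction are HYPOTHESES (J4's output).  NOT a claim about [Balaban1985RegularSpaces]
Thm 2 ∕ Prop 5, the stub, the crux, the rung or the mass gap; no summit statement is proved by this seat.

References: T. Bałaban, CMP **99** (1985) 75–102 [Balaban1985RegularSpaces] (1.29) p.81, (1.38) p.82, (1.131) p.99; CMP **99** (1985) 389–434 [Balaban1985BackgroundPropagators]
(3.19)–(3.24) pp.393–394; CMP **96** (1984) 223–250 [Balaban1984PropagatorsII] (2.1)–(2.4) p.224, (2.14)–(2.15) p.225; CMP **102** (1985) 277–309 [Balaban1985Variational]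
(144) p.300, (153) p.301.
-/

set_option autoImplicit false

noncomputable section

open scoped BigOperators Matrix.Norms.L2Operator

namespace Summit.QuantumFields.YangMills.Theorems.HalvingP1FlatCoreTransportAssembly

open Literature.MathematicalPhysics.QuantumFieldTheory.Balaban1983to89
open Literature.MathematicalPhysics.QuantumFieldTheory.Balaban1983to89.T3ContinuumYM3Torus
open B7Prop1Explicit renaming Site → LSite
open B7Prop1Explicit (e)
open B7Prop1Local (InBox)
open B8Ineq132 (covDeriv)
open B8Eq131Cubes (cube flm gs cube_eq margin_succ bLo bHi)
open B8Eq138LandauZd (covDivB covLap QT)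
open B8Eq191FlatStencils (covLap_flat_apply covDeriv_flat_apply)
open B5Eq117TorusCarriers (Mk)
open B5Eq118OneStroke (iterBlockOf iterBlockOf_zero iterBlockOf_succ)
open B5Prop12FieldsLattice (distSite)
open B5RowSumsP12Lattice (distSite_comm distSite_triangle)
open B6SectADomainsV1 (Domains)
open B6SectAOperatorsV1 (SiteIdx)
open B10Eq27TorusAxialLog (transl transl_apply transl_add transl_add_e rel pull)
open B15Eq112TorusCover (cover lift)
open LatticeFieldCalculus (laplace diverg siteAvgIter)
open FlatCubeSequenceAligned (cubeSeqMT3 cubeSeqM cubeSetM cubeFinM cubeSeqM_Om_pos inOm_cubeSeqM_iff mem_cubeFinM_of_dist blockOf_mem_cubeFinM)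
open HalvingP1FlatPillarPrime (sep22_cubeFinM_zero)
open HalvingSliceDictionary (covLap_covDivB_one_pull)
open P1FlatCoreCubeInclusion (transl_zero_eq_cover cover_lift_add_rel lift_add_rel_mem_cube_zero mem_cube_of_cover_mem_cubeSetM iterBlockOf_cover_eq_iff_flm_eq)
open HalvingP1FlatCoreTransport (multiplierForm_of_cellConst)
open HalvingP1FlatCoreTransportZd (QT_one_eq_of_flm_eq)

/-! ## §1 Locality of the flat stencils on `ℤᵈ` -/

section Stencils

variable {d : ℕ} {𝔸 : Type*} [NormedRing 𝔸] [NormedAlgebra ℂ 𝔸]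

/-- `D^{η*}_1X(x) = Σ_μ η⁻¹(X(x − e_μ, μ) − X(x, μ))` reads `X` on the `2d` bonds `(x, μ)`, `(x − e_μ, μ)`. [cite: Balaban1985BackgroundPropagators, (3.23) p.394] -/
theorem covDivB_one_congr (η : ℝ) {X X' : LSite d → Fin d → 𝔸} {x : LSite d} (h0 : ∀ μ, X x μ = X' x μ)
    (h1 : ∀ μ, X (x - e μ) μ = X' (x - e μ) μ) :
    covDivB η (1 : LSite d → Fin d → 𝔸ˣ) X x = covDivB η (1 : LSite d → Fin d → 𝔸ˣ) X' x := by
  unfold covDivB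
  refine Finset.sum_congr rfl fun μ _ => ?_
  rw [covDeriv_flat_apply η μ (fun z => X z μ) x, covDeriv_flat_apply η μ (fun z => X' z μ) x, h0 μ, h1 μ]

/-- `Δ^η_1 f(x)` reads `f` at `x`, `x ± e_μ`. [cite: Balaban1985BackgroundPropagators, (3.23) p.394] -/
theorem covLap_one_congr (η : ℝ) {f f' : LSite d → 𝔸} {x : LSite d} (h0 : f x = f' x) (hp : ∀ μ, f (x + e μ) = f' (x + e μ))
    (hm : ∀ μ, f (x - e μ) = f' (x - e μ)) :
    covLap η (1 : LSite d → Fin d → 𝔸ˣ) f x = covLap η (1 : LSite d → Fin d → 𝔸ˣ) f' x := by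
  rw [covLap_flat_apply, covLap_flat_apply]
  refine Finset.sum_congr rfl fun μ _ => ?_
  rw [h0, hp μ, hm μ]

/-- **THE `Ω₀`-INDICATOR IS INVISIBLE TWO STEPS INSIDE**: if `x`, `x ± e_μ` lie in `Ω₀` then `Δ^η_1(𝟙_{Ω₀}g)(x) = Δ^η_1 g(x)` (the Dirichlet reading of ✓`IsLandau138`).
[cite: Balaban1985BackgroundPropagators, (3.23)-(3.25) p.394] -/
theorem covLap_one_indicator_eq (η : ℝ) {Ω₀ : Set (LSite d)} {g : LSite d → 𝔸} {x : LSite d} (hx : x ∈ Ω₀) (hp : ∀ μ, x + e μ ∈ Ω₀)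
    (hm : ∀ μ, x - e μ ∈ Ω₀) :
    covLap η (1 : LSite d → Fin d → 𝔸ˣ) (Ω₀.indicator g) x = covLap η (1 : LSite d → Fin d → 𝔸ˣ) g x :=
  covLap_one_congr η (Set.indicator_of_mem hx g) (fun μ => Set.indicator_of_mem (hp μ) g) (fun μ => Set.indicator_of_mem (hm μ) g)

end Stencils

/-! ## §2 The footprint junction with a torus one-form -/

section Junction

variable {P : Params} {N : ℕ}

/-- Coordinates of the eleven sites `z`, `z ± e_ν`, `z ± e_ν − e_μ`, `z − e_μ` of the footprint of `Δ^η_1D^{η*}_1` at `z` lie in `[z − 2, z + 1]`. [folklore] -/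
private theorem footprint_bounds {d : ℕ} (z : LSite d) (ν μ : Fin d) (i : Fin d) :
    (z i - 2 ≤ z i ∧ z i ≤ z i + 1) ∧
    (z i - 2 ≤ (z - e μ) i ∧ (z - e μ) i ≤ z i + 1) ∧
    (z i - 2 ≤ (z + e ν) i ∧ (z + e ν) i ≤ z i + 1) ∧
    (z i - 2 ≤ (z + e ν - e μ) i ∧ (z + e ν - e μ) i ≤ z i + 1) ∧
    (z i - 2 ≤ (z - e ν) i ∧ (z - e ν) i ≤ z i + 1) ∧
    (z i - 2 ≤ (z - e ν - e μ) i ∧ (z - e ν - e μ) i ≤ z i + 1) := by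
  simp only [Pi.add_apply, Pi.sub_apply, e, Pi.single_apply]
  split_ifs <;> omega

/-- ★ **THE FOOTPRINT JUNCTION**: if the `ℤᵈ` one-form `X` agrees with the torus one-form `A` read at the translates, `X w ν = A⟨0 + w, ν⟩`, on every `w` of the box
`[z − 2, z + 1]`, then `Δ^η_1D^{η*}_1X(z) = (Δ_{η⁻¹}∂*_{η⁻¹}A)(0 + z)` (✓`covLap_covDivB_one_pull` for the periodic pull-back, which agrees with `X` on the footprint).
[cite: Balaban1985RegularSpaces, (1.38) p.82; Balaban1985BackgroundPropagators, (3.23) p.394] -/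
theorem covLap_covDivB_one_eq_laplace_diverg (η : ℝ) (A : PBond P 0 → Matrix (Fin N) (Fin N) ℂ) (X : LSite P.d → Fin P.d → Matrix (Fin N) (Fin N) ℂ)
    (z : LSite P.d) (hagree : ∀ w : LSite P.d, (∀ i, z i - 2 ≤ w i ∧ w i ≤ z i + 1) → ∀ ν, X w ν = A ⟨transl 0 w, ν⟩) :
    covLap η (1 : LSite P.d → Fin P.d → (Matrix (Fin N) (Fin N) ℂ)ˣ) (covDivB η (1 : LSite P.d → Fin P.d → (Matrix (Fin N) (Fin N) ℂ)ˣ) X) z =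
      laplace η⁻¹ (diverg η⁻¹ A) (transl 0 z) := by
  rw [← covLap_covDivB_one_pull η A z]
  have hX : ∀ w : LSite P.d, (∀ i, z i - 2 ≤ w i ∧ w i ≤ z i + 1) → ∀ ν, X w ν = pull A 0 w ν := fun w hw ν => hagree w hw ν
  refine covLap_one_congr η ?_ (fun ν => ?_) (fun ν => ?_)
  · exact covDivB_one_congr η (fun μ => hX z (fun i => (footprint_bounds z μ μ i).1) μ)
      (fun μ => hX (z - e μ) (fun i => (footprint_bounds z μ μ i).2.1) μ)
  · exact covDivB_one_congr η (fun μ => hX (z + e ν) (fun i => (footprint_bounds z ν μ i).2.2.1) μ)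
      (fun μ => hX (z + e ν - e μ) (fun i => (footprint_bounds z ν μ i).2.2.2.1) μ)
  · exact covDivB_one_congr η (fun μ => hX (z - e ν) (fun i => (footprint_bounds z ν μ i).2.2.2.2.1) μ)
      (fun μ => hX (z - e ν - e μ) (fun i => (footprint_bounds z ν μ i).2.2.2.2.2) μ)

end Junction

/-! ## §3 Margins: footprints stay inside the windows; nesting of the route cubes -/

section Margins

variable {d : ℕ}

/-- **THE BOX `[z − 2, z + 2]` OF A SITE OF `□₁^{N05}` LIES IN `□₀^{N05}`** (`1 ≤ k`, `2 ≤ ρ′`): the margin of `□₀` over `□₁` is exactly `ρ′` (✓`margin_succ` at `j = 0`).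
[cite: Balaban1985RegularSpaces, p.98 («a distance between boundaries of these cubes is equal to R₁M₁Lʲη»)] -/
theorem mem_cube_zero_of_near_mem_cube_one {L : ℕ} {a : LSite d} {M ρ k : ℕ} (hk : 1 ≤ k) (hρ : 2 ≤ ρ) {z : LSite d}
    (hz : z ∈ cube L a M ρ k 1) (w : LSite d) (hw : ∀ i, z i - 2 ≤ w i ∧ w i ≤ z i + 2) : w ∈ cube L a M ρ k 0 := by
  rw [cube_eq hk] at hz
  rw [cube_eq (Nat.zero_le k)]
  have hmar : L ^ 0 * (ρ * gs L (k - 0)) = L ^ (0 + 1) * (ρ * gs L (k - (0 + 1))) + ρ * L ^ 0 := margin_succ (by omega)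
  simp only [pow_zero, one_mul, Nat.sub_zero, Nat.zero_add, mul_one, pow_one] at hmar
  simp only [Set.mem_setOf_eq, InBox, bLo, bHi, pow_one, pow_zero, one_mul, Nat.sub_zero] at hz ⊢
  intro i
  obtain ⟨h1, h2⟩ := hz i
  obtain ⟨h3, h4⟩ := hw i
  have hρ2 : (2 : ℤ) ≤ (ρ : ℤ) := by exact_mod_cast hρ
  rw [hmar]
  push_cast at h1 h2 ⊢
  constructor <;> linarith

variable {P : Params}

/-- `dist₀(0 + z, 0 + w) ≤ R` when `|z_i − w_i| ≤ R` coordinatewise (✓`HalvingSiteAssembly.distSite_transl_le_one` for general `R`). [folklore] -/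
theorem distSite_transl_le_of_natAbs_le {y y' : LSite P.d} {R : ℕ} (h : ∀ i, (y i - y' i).natAbs ≤ R) :
    distSite (Mk P 0) (transl (0 : Site P 0) y) (transl 0 y') ≤ (R : ℝ) := by
  unfold distSite
  have key : (Finset.univ.sup fun μ : Fin P.d => (((transl (0 : Site P 0) y) μ - (transl (0 : Site P 0) y') μ).valMinAbs).natAbs) ≤ R := by
    refine Finset.sup_le fun μ _ => ?_
    have hsub : (transl (0 : Site P 0) y) μ - (transl (0 : Site P 0) y') μ = ((y μ - y' μ : ℤ) : ZMod (P.sitesPerDir 0)) := by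
      rw [transl_apply, transl_apply]; push_cast; ring
    rw [hsub]
    exact (ZMod.natAbs_min_of_le_div_two _ _ _ (ZMod.coe_valMinAbs _) (ZMod.natAbs_valMinAbs_le _)).trans (h μ)
  exact_mod_cast key

/-- **TORUS SITES WITHIN `2` OF A SITE OF `□₁^{route}` LIE IN `□₀^{route}`** (`1 ≤ k ≤ m + K`, `1 ≤ M`, `2 ≤ S`; ✓`sep22_cubeFinM_zero`).
[cite: Balaban1984PropagatorsII, (2.2) p.224; Balaban1985Variational, (144) p.300] -/
theorem transl_mem_cubeSetM_zero_of_near {x₀ : Site P 0} {k : ℕ} (hk : k ≤ P.m + P.K) (hk1 : 1 ≤ k) {ρ S M : ℕ} (hM : 1 ≤ M) (hS : 2 ≤ S)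
    {z w : LSite P.d} (hz : transl (0 : Site P 0) z ∈ cubeSetM x₀ k ρ S M 1) (hw : ∀ i, (z i - w i).natAbs ≤ 2) :
    transl (0 : Site P 0) w ∈ cubeSetM x₀ k ρ S M 0 := by
  have hz1 : iterBlockOf 1 (transl (0 : Site P 0) z) ∈ cubeFinM x₀ k ρ S M 1 := by
    simpa only [cubeSetM, hk1, if_true, Set.mem_setOf_eq] using hz
  have hblk : blockOf (transl (0 : Site P 0) z) ∈ cubeFinM x₀ k ρ S M 1 := by
    rwa [iterBlockOf_succ, iterBlockOf_zero] at hz1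
  simp only [cubeSetM, Nat.zero_le, if_true, Set.mem_setOf_eq, iterBlockOf_zero]
  by_contra hout
  have hsep := sep22_cubeFinM_zero x₀ hk hk1 ρ S M hM _ _ hblk hout
  have hd : distSite (Mk P 0) (transl (0 : Site P 0) z) (transl 0 w) ≤ 2 := by
    exact_mod_cast distSite_transl_le_of_natAbs_le (P := P) hw
  have hS2 : (2 : ℝ) ≤ (S : ℝ) := by exact_mod_cast hS
  linarith

/-- Nesting of the route cubes: `□_j^{route} ⊆ □_1^{route}` for `1 ≤ j ≤ k` (✓`Domains.inOm_of_le` for `cubeSeqM`). [cite: Balaban1984PropagatorsII, (2.1) p.224] -/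
theorem cubeSetM_subset_one {x₀ : Site P 0} {k : ℕ} (hk : k ≤ P.m + P.K) {ρ S M : ℕ} (hM : 1 ≤ M) {j : ℕ} (hj : 1 ≤ j) (hjk : j ≤ k) :
    cubeSetM x₀ k ρ S M j ⊆ cubeSetM x₀ k ρ S M 1 := by
  intro s hs
  have h := (inOm_cubeSeqM_iff (x₀ := x₀) hk (ρ := ρ) (S := S) hM hj hjk s).2 hs
  exact (inOm_cubeSeqM_iff (x₀ := x₀) hk (ρ := ρ) (S := S) hM le_rfl (hj.trans hjk) s).1 ((cubeSeqM x₀ k hk ρ S M hM).inOm_of_le hj h)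

/-- Nesting of the route cubes: `□_1^{route} ⊆ □_0^{route}` (✓`blockOf_mem_cubeFinM` + ✓`mem_cubeFinM_of_dist`). [cite: Balaban1984PropagatorsII, (2.1) p.224] -/
theorem cubeSetM_one_subset_zero {x₀ : Site P 0} {k : ℕ} (hk : k ≤ P.m + P.K) (hk1 : 1 ≤ k) {ρ S M : ℕ} (hM : 1 ≤ M) :
    cubeSetM x₀ k ρ S M 1 ⊆ cubeSetM x₀ k ρ S M 0 := by
  intro s hs
  have hs1 : iterBlockOf 1 s ∈ cubeFinM x₀ k ρ S M 1 := by
    simpa only [cubeSetM, hk1, if_true, Set.mem_setOf_eq] using hs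
  have hblk : blockOf (iterBlockOf 0 s) ∈ cubeFinM x₀ k ρ S M (0 + 1) := by
    rwa [iterBlockOf_succ] at hs1
  have hd := blockOf_mem_cubeFinM (x₀ := x₀) (ρ := ρ) (S := S) hM hk (j := 0) (by omega) hblk
  simp only [cubeSetM, Nat.zero_le, if_true, Set.mem_setOf_eq]
  exact mem_cubeFinM_of_dist x₀ k ρ S M 0 hd

end Margins

/-! ## §4 The assembly: (iv) on the route tower from N05's flat Landau condition on its window -/

section Assembly

variable {F : T3Family} {n K : ℕ}

/-- ★★★ **THE PILLAR's LANDAU ROW (iv) ON THE ROUTE's CUBE TOWER FROM N05's FLAT LANDAU CONDITION ON ITS WINDOW.**  Data: the route member `(F, n, K)`, site `x₀`,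
cube data `(ρ, S, M)` (`1 ≤ M`, `2 ≤ S`); N05's window `□₀^{N05} = cube L a M′ ρ′ (K−n) 0` with J1b's binders (`ρ + M ≤ ρ′ + 1`, `L + S + M ≤ ρ′ + 2`, the corner `a`, the
room premise in fine units) and `2 ≤ ρ′`; layers `Λs` with the vanishing property «a site of `□_j^{N05}` has no block ancestor of level `j′ < j` in `Λs j′`» (✓part 2a:
`LamP`, `cubeLam`); the torus one-form `A`, the `ℤ³` one-form `X` and multiplier `μ` with (a) the FLAT LANDAU CONDITION `Δ↾Ω₀ ∂*X = Q′(1)ᵀμ` on `Ω₀` (✓`IsLandau138 … 1 X`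
unfolded, ✓`QT`) and (b) the POINTWISE JUNCTION `X w ν = A⟨0+w, ν⟩` for `w ∈ Ω₀` whenever the torus bond `⟨0+w, ν⟩` has both ends in `□₀^{route}`.  Conclusion: conjunct (iv)
of ✓`P1FlatPillarAt'` for `A` on `cubeSeqMT3 F n K x₀ ρ S M hM` with lattice factor `η⁻¹`.  Proof: part 1's cell currency; a route cell of level `j ≥ 1` has its sites in
`□_j^{route} ⊆ □_1^{route}`, their representatives in `□_j^{N05}` with equal `⌊·∕Lʲ⌋` (J1b), where `Δ∂*A = Δ^η_1D^{η*}_1X = Q′(1)ᵀμ` (footprint junction two sites inside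
`Ω₀`) takes one value (part 2a); level-0 cells are singletons.
[cite: Balaban1985RegularSpaces, (1.29) p.81, (1.38) p.82, (1.131) p.99; Balaban1984PropagatorsII, (2.14)-(2.15) p.225; Balaban1985Variational, (144) p.300, (153) p.301] -/
theorem multiplierForm_of_flatLandau_window (hnK : n < K) (x₀ : Site (F.P K) 0) (ρ S M : ℕ) (hM : 1 ≤ M) (hS : 2 ≤ S)
    {a : LSite (F.P K).d} {M' ρ' : ℕ} (hρ' : 2 ≤ ρ') (h0 : ρ + M ≤ ρ' + 1) (h1 : (F.P K).L + S + M ≤ ρ' + 2)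
    (ha : ∀ ν, a ν ≤ ((iterBlockOf (K - n) x₀ ν).val : ℤ) ∧ ((iterBlockOf (K - n) x₀ ν).val : ℤ) ≤ a ν + M' - 1)
    (hroom : 2 * ((F.P K).L ^ (K - n) * (M' + 1) + ρ' * gs (F.P K).L (K - n)) ≤ (F.P K).sitesPerDir 0)
    (Λs : ℕ → Set (LSite (F.P K).d))
    (hΛ : ∀ j, 1 ≤ j → j ≤ K - n → ∀ j', j' < j → ∀ z ∈ cube (F.P K).L a M' ρ' (K - n) j, flm (F.P K).L j' z ∉ Λs j')
    (η : ℝ) (A : PBond (F.P K) 0 → Matrix (Fin 2) (Fin 2) ℂ) (X : LSite (F.P K).d → Fin (F.P K).d → Matrix (Fin 2) (Fin 2) ℂ)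
    (μ : ℕ → LSite (F.P K).d → Matrix (Fin 2) (Fin 2) ℂ)
    (hLan : ∀ z ∈ cube (F.P K).L a M' ρ' (K - n) 0,
      covLap η (1 : LSite (F.P K).d → Fin (F.P K).d → (Matrix (Fin 2) (Fin 2) ℂ)ˣ)
          ((cube (F.P K).L a M' ρ' (K - n) 0).indicator
            (covDivB η (1 : LSite (F.P K).d → Fin (F.P K).d → (Matrix (Fin 2) (Fin 2) ℂ)ˣ) X)) z =
        QT (F.P K).L (K - n) Λs (1 : LSite (F.P K).d → Fin (F.P K).d → (Matrix (Fin 2) (Fin 2) ℂ)ˣ) μ z)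
    (hpt : ∀ w ∈ cube (F.P K).L a M' ρ' (K - n) 0, ∀ ν : Fin (F.P K).d,
      transl (0 : Site (F.P K) 0) w ∈ cubeSetM x₀ (K - n) ρ S M 0 → (transl (0 : Site (F.P K) 0) w).shift ν ∈ cubeSetM x₀ (K - n) ρ S M 0 →
      X w ν = A ⟨transl 0 w, ν⟩) :
    ∃ μ' : SiteIdx (cubeSeqMT3 F n K x₀ ρ S M hM) → Matrix (Fin 2) (Fin 2) ℂ, ∀ s : Site (F.P K) 0,
      laplace η⁻¹ (diverg η⁻¹ A) s =
        ∑ i : SiteIdx (cubeSeqMT3 F n K x₀ ρ S M hM), siteAvgIter (i.1.1 : ℕ) (Pi.single s (1 : ℝ)) i.1.2 • μ' i := by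
  classical
  have hk : K - n ≤ (F.P K).m + (F.P K).K := FlatMinimizerH.le_T3 F n K
  have hk1 : 1 ≤ K - n := by omega
  -- representatives (J1b)
  have hrep_cover : ∀ s : Site (F.P K) 0, transl (0 : Site (F.P K) 0) (lift (F.P K) x₀ + rel x₀ s) = s := fun s => by
    rw [transl_zero_eq_cover]; exact cover_lift_add_rel x₀ s
  have hrep0 : ∀ s ∈ cubeSetM x₀ (K - n) ρ S M 0, lift (F.P K) x₀ + rel x₀ s ∈ cube (F.P K).L a M' ρ' (K - n) 0 :=
    fun s hs => lift_add_rel_mem_cube_zero hk hM h0 h1 ha hs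
  have hrepj : ∀ j, j ≤ K - n → ∀ s ∈ cubeSetM x₀ (K - n) ρ S M j, s ∈ cubeSetM x₀ (K - n) ρ S M 0 →
      lift (F.P K) x₀ + rel x₀ s ∈ cube (F.P K).L a M' ρ' (K - n) j := fun j hjk s hsj hs0 =>
    mem_cube_of_cover_mem_cubeSetM hk hM h0 h1 ha hroom hjk (hrep0 s hs0) (by rw [← transl_zero_eq_cover, hrep_cover]; exact hsj)
  -- KEY: at a site of `□₁^{route}`, `Δ∂*A` is N05's `Q′(1)ᵀμ` at the representative
  have hval : ∀ s ∈ cubeSetM x₀ (K - n) ρ S M 1,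
      laplace η⁻¹ (diverg η⁻¹ A) s = QT (F.P K).L (K - n) Λs (1 : LSite (F.P K).d → Fin (F.P K).d → (Matrix (Fin 2) (Fin 2) ℂ)ˣ) μ
        (lift (F.P K) x₀ + rel x₀ s) := by
    intro s hs1
    have hs0 : s ∈ cubeSetM x₀ (K - n) ρ S M 0 := cubeSetM_one_subset_zero hk hk1 hM hs1
    have hz0 := hrep0 s hs0
    have hz1 : lift (F.P K) x₀ + rel x₀ s ∈ cube (F.P K).L a M' ρ' (K - n) 1 := hrepj 1 hk1 s hs1 hs0
    have hbox : ∀ w : LSite (F.P K).d, (∀ i, (lift (F.P K) x₀ + rel x₀ s) i - 2 ≤ w i ∧ w i ≤ (lift (F.P K) x₀ + rel x₀ s) i + 2) →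
        w ∈ cube (F.P K).L a M' ρ' (K - n) 0 := mem_cube_zero_of_near_mem_cube_one hk1 hρ' hz1
    have hzs : transl (0 : Site (F.P K) 0) (lift (F.P K) x₀ + rel x₀ s) ∈ cubeSetM x₀ (K - n) ρ S M 1 := by rw [hrep_cover]; exact hs1
    have hagree : ∀ w : LSite (F.P K).d, (∀ i, (lift (F.P K) x₀ + rel x₀ s) i - 2 ≤ w i ∧ w i ≤ (lift (F.P K) x₀ + rel x₀ s) i + 1) →
        ∀ ν, X w ν = A ⟨transl 0 w, ν⟩ := by
      intro w hw ν
      have hw0 : w ∈ cube (F.P K).L a M' ρ' (K - n) 0 := hbox w fun i => ⟨(hw i).1, by linarith [(hw i).2]⟩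
      refine hpt w hw0 ν ?_ ?_
      · exact transl_mem_cubeSetM_zero_of_near hk hk1 hM hS hzs fun i => by
          have := hw i
          simp only [Pi.add_apply] at this ⊢
          omega
      · rw [← transl_add_e]
        exact transl_mem_cubeSetM_zero_of_near hk hk1 hM hS hzs fun i => by
          have := hw i
          simp only [Pi.add_apply, e, Pi.single_apply] at this ⊢
          split_ifs <;> omega
    have hj := covLap_covDivB_one_eq_laplace_diverg η A X (lift (F.P K) x₀ + rel x₀ s) hagree
    rw [hrep_cover] at hj
    have hind := covLap_one_indicator_eq η (g := covDivB η (1 : LSite (F.P K).d → Fin (F.P K).d → (Matrix (Fin 2) (Fin 2) ℂ)ˣ) X) hz0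
      (fun ν => hbox _ fun i => by simp only [Pi.add_apply, e, Pi.single_apply]; split_ifs <;> omega)
      (fun ν => hbox _ fun i => by simp only [Pi.sub_apply, e, Pi.single_apply]; split_ifs <;> omega)
    rw [← hj, ← hind]
    exact hLan _ hz0
  -- cell constancy of `Δ∂*A` on the route's index cells
  refine multiplierForm_of_cellConst (cubeSeqMT3 F n K x₀ ρ S M hM) (f := laplace η⁻¹ (diverg η⁻¹ A))
    (fun j y => if h : ∃ s : Site (F.P K) 0, iterBlockOf j s = y then laplace η⁻¹ (diverg η⁻¹ A) h.choose else 0) ?_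
  intro j y hLam s hsy
  have hex : ∃ s' : Site (F.P K) 0, iterBlockOf j s' = y := ⟨s, hsy⟩
  rw [dif_pos hex]
  have hs'y : iterBlockOf j hex.choose = y := hex.choose_spec
  rcases Nat.eq_zero_or_pos j with hj0 | hjpos
  · -- level `0`: the cell is the single site `y`
    subst hj0
    rw [iterBlockOf_zero] at hsy hs'y
    rw [hsy, hs'y]
  · -- level `j ≥ 1`: both sites lie in `□_j^{route}`; their representatives share `⌊·∕Lʲ⌋` inside `□_j^{N05}`
    have hjk : j ≤ K - n := (cubeSeqMT3 F n K x₀ ρ S M hM).le_of_lamSite hLam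
    have hmem : ∀ t : Site (F.P K) 0, iterBlockOf j t = y → t ∈ cubeSetM x₀ (K - n) ρ S M j := fun t ht =>
      (inOm_cubeSeqM_iff (x₀ := x₀) hk (ρ := ρ) (S := S) hM hjpos hjk t).1
        (show iterBlockOf j t ∈ (cubeSeqMT3 F n K x₀ ρ S M hM).Om j by rw [ht]; exact hLam.1)
    have hs := hmem s hsy
    have hs' := hmem hex.choose hs'y
    have hs1 := cubeSetM_subset_one hk hM hjpos hjk hs
    have hs'1 := cubeSetM_subset_one hk hM hjpos hjk hs'
    have hs0 := cubeSetM_one_subset_zero hk hk1 hM hs1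
    have hs'0 := cubeSetM_one_subset_zero hk hk1 hM hs'1
    rw [hval s hs1, hval hex.choose hs'1]
    have hz := hrepj j hjk s hs hs0
    have hz' := hrepj j hjk hex.choose hs' hs'0
    have hflm : flm (F.P K).L j (lift (F.P K) x₀ + rel x₀ s) = flm (F.P K).L j (lift (F.P K) x₀ + rel x₀ hex.choose) := by
      refine (iterBlockOf_cover_eq_iff_flm_eq hk hroom hjk (hrep0 s hs0) (hrep0 hex.choose hs'0)).1 ?_
      rw [← transl_zero_eq_cover, ← transl_zero_eq_cover, hrep_cover, hrep_cover, hsy, hs'y]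
    exact QT_one_eq_of_flm_eq (F.P K).L (K - n) Λs μ hflm fun j' hj' =>
      ⟨hΛ j hjpos hjk j' hj' _ hz, hΛ j hjpos hjk j' hj' _ hz'⟩

end Assembly

end Summit.QuantumFields.YangMills.Theorems.HalvingP1FlatCoreTransportAssembly

end
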